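import Mathlib
import HarnessLib
import HarnessLib.Audit
import Summits.BirchSwinnertonDyer.Statement
import Summits.BirchSwinnertonDyer.Rank1Residual.WAll.Target
import Summits.BirchSwinnertonDyer.Rank1Residual.Supersingular.SharpFlatRankZeroReal
import Summits.BirchSwinnertonDyer.BirchSwinnertonDyer.Theorems.SprungSharpFlatMainConjecture
import Literature.NumberTheory.EllipticCurves.Rank1Residual.Typed.X8
import Literature.NumberTheory.EllipticCurves.BurungaleKobayashiOta2024.RankOnePPartOfSharpFlatMainConjecture
import Literature.NumberTheory.EllipticCurves.Sprung2012.SharpFlatKatoDivisibility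
import Literature.NumberTheory.EllipticCurves.Sprung2012.ColemanMapTheorems
import Literature.NumberTheory.EllipticCurves.Sprung2024.ChromaticCharValueRankZeroAllN
import Literature.NumberTheory.EllipticCurves.ModularCurvePeriodRatio
import Literature.NumberTheory.EllipticCurves.CuspFormLFunction
import Literature.NumberTheory.EllipticCurves.AnalyticRank
import Literature.NumberTheory.EllipticCurves.Sprung2012.SharpFlatColemanKatoZeta
import Summits.BirchSwinnertonDyer.BirchSwinnertonDyer.Theorems.SignedLowerHalvesRealPeriodUnitPlusPeriod
import HarnessLib.Audit.Status.Attr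

/-!
Route: PrintX8

CLOSED (superseded) 2026-08-27T23:05:07Z by planner-bsd-print-x8-plan-g10-0 — reason: superseded:route-BirchSwinnertonDyer-PrintX8VS — superseded by route-BirchSwinnertonDyer-PrintX8VS — note: W-57: duplicate vehicle to W-ALL/8; VS = route of record (21705 THEOREM B closed p576172; only open load-bearing item 19875 shared); moot 20622/20714/20402; LINE LS evidence (657/657 levels j287967) stays attached to 20714 as record. Director-bsd g11 word «SUPERSEDE» 2026-08-27T22:56:58Z (HOME INBOX. The file is kept as the record of this route; refuted decls are indexed as negative knowledge (`ledger negatives`).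

It suffices to show, for every X8 pair (E, 3) — 3 a prime of good supersingular reduction with a_3 =
±3 — of
analytic rank ≤ 1: (C1) Sprung's ♯/♭ main conjecture at (E, 3) (tree leaf
`Theorems.SprungSharpFlatMainConjecture`,
= Kato's IMC at (E,3) by Sprung 2012 Prop. 7.19), and the two PRINTED links "main conjecture ⇒
3-part of the BSD
formula" read at (3, ±3): (C2) rank one, Burungale–Kobayashi–Ota 2024 App. A Cor. A.5 (any level,
any non-ordinary good p);
(C3) rank zero, Sprung 2024 §5.2 (Lemmas 5.5–5.9 ⇒ Thm. 5.3, all N via the typed Lemma 5.9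
identity). With
Gross–Zagier–Kolyvagin by name the X8 leaf `WAllCornerX8` (rung W-ALL/8) follows by a case split on
the analytic rank.
Since rev 2 the three are DERIVED: C2, C3 from the published inputs BY NAME (glue items
GlueRankOneLinkX8 /
GlueRankZeroLinkX8 over PublishedInputsX8, split into eight Input* named facts), and C1 through
GlueMainConjectureX8 from
(K1) `SprungLowerDivisibilityAtThree`, the Eisenstein half on all of X8 (route SignedLowerHalves'
item, attached by name;
on the 156 big-image pairs it gives the full main conjecture with Sprung 2012 Thms 7.14/7.16 +
Wuthrich 2014 Lemma 20),
and (SmallImage) `SharpFlatMainConjectureSmallImageX8`, the full ♯/♭ main conjecture on the X8 pairs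
with non-surjective
ρ̄_{E,3} (image N_ns⁺(3)), where no integral Kato divisibility is in print. Since rev 7 SmallImage
is itself DERIVED
(glue item GlueMuBoundSmallImageX8, p3's class form p540766): given K1 and the published inputs,
Sprung's Main Conjecture
7.21 on those pairs (a CLASS: every E/ℚ good supersingular at 3 with a₃ = ±3 and ρ̄_{E,3} not onto;
61 census cells) is EXACTLY one inequality of μ-invariants per pair and colour, (Mu)
`MuBoundSmallImageX8`:
μ(X^•(E/ℚ_∞)) ≤ μ(Λ/(L^•_3(E))); and since rev 11 Mu is SPLIT (glued split, k = 2: generated glue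
GlueMuAnSmallImageX8 = p1's Euler-system
μ-transfer at NON-surjective image p545102 over the held construction fact
`Sprung2012.thm714seq_sharpFlatColemanKato_zeta`
p543968 and the period unit, child InputSharpFlatMuTransfer) so that its open input is the ANALYTIC
RIDER (An, child crux) `SharpFlatMuAnSmallImageX8` — on every such small-image
pairs, for each colour, the non-zero member L^• of the Sprung pair has unit content (analytic μ = 0;
Perrin-Riou 2003
Conj. 7.1 read ♯/♭, restricted to this family — OPEN class-wide), certifiable curve by curve by a
finite Mazur–Tate
computation (61/61 census cells read μ = 0 at both parities, engine B).
X = K1 ∧ Mu ∧ (published inputs by name) ∧ GZK, with Mu ⟸ An ∧ (♯/♭ Coleman–Kato fact, period unit)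
— `closes` unchanged (binds hMu). No idea card (explicit print-tier unit).
Lean: `Summit.BirchSwinnertonDyer.BirchSwinnertonDyer.Theses.PrintX8.SprungLowerDivisibilityAtThree
∧
Summit.BirchSwinnertonDyer.BirchSwinnertonDyer.Theses.PrintX8.MuBoundSmallImageX8 ∧
Summit.BirchSwinnertonDyer.BirchSwinnertonDyer.Theses.PrintX8.PublishedInputsX8 ∧
Summit.BirchSwinnertonDyer.BirchSwinnertonDyer.Theses.PrintX8.RankEqAnalyticRankLeOne`

CLOSES_TARGET: closes rung W-ALL/8 of BirchSwinnertonDyer: Summit.BirchSwinnertonDyer.WAllCornerX8 (D-0061; not the summit Statement) — the deciding theorem of this route concludes that registered leaf instead of the Statement decl `BirchSwinnertonDyer` (class rung: servable and labelled, never counted as concluding the summit Statement).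

Rationale: WHY THIS LINE. PRINT TIER (D-0131 (2), cell bsd-print-x8): the mechanism is importation BY NAME of
the refereed "IMC ⇒ p-part of BSD" theorems that cover a_p ≠ 0 — BurungaleKobayashiOta2023 App. A
Cor. A.5 (rank 1; "p non-ordinary (good)", weight 2 on Γ0(M), p ∤ M; lever Cor. A.3/A.4: one of the
two cyclotomic p-adic heights is non-trivial, Fontaine–Laffaille) and Sprung2024 §5.2 (rank 0;
Euler-characteristic identity + control, typed all-N as
`Sprung2024.lem59AllN_sharpFlatCharValue_rankZero`, control Lemma 5.6 discharged in the tree) —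
composed with Sprung2012 Prop. 7.19 / Main Conj. 7.21 (♯/♭ MC ⟺ Kato's MC at (E,3)), so that the
ONLY non-published input on the whole leaf (217 census rows, both ranks, both 3-adic images) is ONE
Λ-adic statement, the ♯/♭ main conjecture on X8 (C1), open in print at a_3 = ±3 (Sprung2024 Thm. 1.1
is conditional on Conj. 3.33 AND takes its Eisenstein input from Thm 3.29 = CastellaLiuWan2022 Thm
8.2.1 / Wan Thm 2.15 at ξ = 𝟙 — PRE/OPEN, the GAP(G2) instantiation (p1 g2 page verdict) — on
square-free N; CastellaCiperianiSkinnerSprung2018 Thm. C/D rests on a withdrawn preprint;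
BurungaleSkinnerTianWan2024 Thm. 2.1/Cor. 2.2 and (1.7)/(h4) require a_p = 0, verdict
`ClassX8.not_bstw_h4`). Imported area: cyclotomic Iwasawa theory and p-adic Hodge theory; no
cross-field transplant (print tier). ATTACKED SLICE (tribunal J 15:50:54Z, named): K1
`SprungLowerDivisibilityAtThree` is the declared RESIDUAL (K3's crux by name); GIVEN K1, what this
route attacks is, in μ-currency, BSD₃ on the rank-0 small-image X8 pairs (60 census cells) and the
♯/♭ main conjecture at the rank-1 small-image pair (478400hc1) — i.e. exactly Mu
`MuBoundSmallImageX8`, earned through the analytic rider An `SharpFlatMuAnSmallImageX8` + held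
inputs (split glue); on the 156 big-image pairs K1 + print already give C1. What it does that the
research route SignedLowerHalves (K3) does not: K3 PROVES the Eisenstein half on typed objects and
closes the r = 0 ∧ (surj(3) ∨ semistable) cells through Wuthrich's upper bound, leaving rank 1 and
the 61 image-3Nn cells as an OUTPUT-shaped residual (`MissingPPartAt`, its item 19004, line of
record L5-CM = CM-partner congruence transfer via Corpuz–Lei, PRE, 37 partnered cells); here the
residual is MECHANISM-shaped: K1 by name (19875, never restated, referee R-0/R-2) plus — since rev
7, after p3's μ-reading (p539576/p540766, R-30/R-35 PASS) — ONE μ-inequality on the small-image X8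
pairs (`MuBoundSmallImageX8`, 20622; a class — 61 census cells), itself SPLIT since rev 11 (k = 2,
generated glue) through p1 g2's partner-free Euler-system μ-transfer at NON-surjective image
(p545102: 4th and first ♯/♭ client of the tree's UNCONDITIONAL reduction-free core
`CoreAssembly.coreOdd_anyReduction_holds`, over the held ♯/♭ Coleman–Kato construction fact p543968)
— leaving as the open input the analytic rider `SharpFlatMuAnSmallImageX8` (unit content of L^•_3(E)
for every such curve = Perrin-Riou 2003 Conj. 7.1 on this family — OPEN class-wide, certifiable
curve by curve; 61/61 census cells certified μ = 0 by engine B). Negatives index: one unrelated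
ordinary-prime entry (stmt-15532); nothing on X8.

RANKED CRUXES. #3 SprungLowerDivisibilityAtThree (crux, = SignedLowerHalves item 19875 BY NAME,
shared, staffed once) — the Eisenstein half L^• | char X^• of Sprung's ♯/♭ main conjecture on ALL X8
pairs, both colours, no rank hypothesis; with Sprung 2012 Thms 7.14/7.16 + Wuthrich 2014 Lemma 20 it
gives the full MC on the 156 big-image pairs (p534029). (why it might fail: in print at (3, ±3) only
conditionally — Sprung 2024 Thm 1.1 ⇐ Conj 3.33 ∧ CLW22 Thm 8.2.1 at ξ = 𝟙 (PRE/OPEN) ∧ N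
square-free; CCSS Thm C on a withdrawn preprint; BSTW needs a_p = 0.) [Sprung2024, Sprung2012,
CastellaLiuWan2022, CastellaCiperianiSkinnerSprung2018, BurungaleSkinnerTianWan2024] #4
MuBoundSmallImageX8 (crux 20622, the binder of `closes`; μ(X^•) ≤ μ(Λ/(L^•)) per small-image pair
and colour; BC7 CLEAN ×2) — SPLIT rev 11 into: #4 SharpFlatMuAnSmallImageX8 (child crux, NEW rev 11;
p1 g2's hμan binder verbatim) — for EVERY X8 pair (E/ℚ good ss at 3, a₃ = ±3) with image N_ns⁺(3) (a
class; 61 census cells): for every colour, newform f and Sprung pair (L♯,L♭): L^• ≠ 0 ⇒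
HasUnitContent(L^•) (analytic μ(L^•_3(E)) = 0). In print = Perrin-Riou 2003 §7.1 Conj. 7.1 (p.170; =
arXiv §6.1 Conj. 6.1.1; a₃ = ±3 = its Table 2) «µ₊ et µ₋ nuls», read ♯/♭ BY PARITY (odd layers ↔ L♯
↔ µ₋, even ↔ L♭ ↔ µ₊: Perrin-Riou p.165, Kobayashi 2003 p.7, Sprung ANT 11 (2017) Table 2 p.912; lit
g4 T16 amendment — Sprung 2017 Cor 3.6 prints the ± labels swapped) — OPEN class-wide (this IS the
item), certifiable per curve (finite Mazur–Tate modular-symbol certificate; unit case = tree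
theorem, 2 cells; 61/61 cells read μ(θ_4) = μ(θ_5) = 0, engine B). BC7 CLEAN. (why it might fail:
one cell whose L^•_3 has non-unit content — stable μ(θ_n) ≥ 1 at one parity — would refute it — none
does: 61/61 census cells CERTIFIED μ(θ_3) = μ(θ_4) = μ(θ_5) = 0 by two engines agreeing
coefficientwise (ty3 g2 kit j284544, HOME/ty3/data/x8_mt61_REPORT.md), a witness, not a proof for
the class; class-wide no theorem or bound in print at a_p ≠ 0 — proving it for the infinite family
is a case of Perrin-Riou's conjecture.) [PerrinRiou2003, Sprung2017, Sprung2012, Pollack2003,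
arXiv:2409.18021, p545102, p543968] DERIVED support (not staffed as cruxes, claimable directly): #2
SharpFlatMainConjectureX8 (C1 ⟸ K1 + SmallImage + inputs, GlueMainConjectureX8 CLOSED p537972);
split glue GlueMuAnSmallImageX8 (An → InputSharpFlatMuTransfer → MuBoundSmallImageX8, provable now
from p545102: `fun hAn hIn => …muBound_smallImageX8_of_sharpFlatMuAn hIn.1 hIn.2 hAn`); #4
SharpFlatMainConjectureSmallImageX8 (item 20402 ⟸ K1 + Mu + inputs, GlueMuBoundSmallImageX8 CLOSED
p544140); #3 SharpFlatRankOneLinkX8 / #4 SharpFlatRankZeroLinkX8 (C2/C3 ⟸ inputs + GZK, glue CLOSED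
p536888); #1 Assembly CLOSED p534640; #9 RankEqAnalyticRankLeOne (GZK by name, shared); #9
PublishedInputsX8 = 8 by-name Input* facts (OfParts CLOSED); #910 InputSharpFlatMuTransfer (child 2)
:= InputSharpFlatColemanKatoZeta ∧ InputPeriodUnitThree (rev 12); #911 InputSharpFlatColemanKatoZeta
= held fact `Sprung2012.thm714seq_sharpFlatColemanKato_zeta` (p543968) 1:1 by name (top-level alias,
so the staffability cone exempts it `item-states`).

TWO-LAYER PLAN. Layer 1 (binders of `closes`, unchanged since rev 8): Assembly ✓, K1, Mu,
PublishedInputsX8 (8 held facts, OfParts ✓), GlueMuBoundSmallImageX8 ✓ (p544140),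
GlueMainConjectureX8 ✓, GlueRankOneLinkX8 ✓, GlueRankZeroLinkX8 ✓, GZK. Layer 2: Mu ⟸ An +
InputSharpFlatMuTransfer (glued split rev 11, glue provable now, p1); PublishedInputsX8 ⟸ its 8
Input* children (OfParts ✓). LINE under An (lemmas ride with `--supports SharpFlatMuAnSmallImageX8`,
never items): (R1) the kernel reading lemma LANDED (p3 g1 p546221
`Theorems/PrintX8MazurTateMuRider.lean`: `forall_chromaticL_muZero_of_mazurTate_odd_even` /
`ClassX8.…` — a certified Mazur–Tate element Θ ≠ 0 with μ(Θ) = 0 at one ODD and one EVEN layer ⇒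
BOTH colours have unit content; λ-free, any image); (R2) 61 × 2 per-cell kernel certificates (Θ, ι Θ
= θ_n, Θ ≠ 0, μ(Θ) = 0) at layers n = 4, 5 in the tree's `MazurTateRecords*` pattern, two engines
(ty3, ONE kit job), = per-cell WITNESSES of An (BC5) landing `--supports` 20714 — they do NOT close
the class-wide item (p1/p3); (R3) the unit case (2 cells) is p1's `PrintX8SharpFlatMuTransferUnit`
already; (R4) BY-NAME closers of Mu from ONE colour of unit content per pair (p546801 §4, p548147)
and, on the rank-0 small-image pairs with 3 ∤ #Ш_an, BSD(E,3) itself from one colour, K1-free and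
image-free (p3 g2 p548892 `X8.bsdp_of_hasUnitContent_of_shaAn_le_…`). HEDGE (p2 g2, rider-free): Mu
⟸ Coates–Sujatha Conj A at (E,3) (μ(X_0) = 0) over the same construction fact — A(E,3) ⟸ classical
μ₃(ℚ(E[3])_cyc) = 0 (CS05 Thm 3.4) or ⟸ A(E′,3) for a 3-congruent partner E′ (Lim–Sujatha 2018 Prop
3.2, tree theorem; 37 CM-partnered cells).

KILL CRITERIA. A certified cell among the 61 with NON-unit content of a non-zero L^•_3(E) (stable
μ(θ_n) ≥ 1 at one parity, two engines) refutes the child An (the split is then re-split: Mu stays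
the binder and is attacked through the other colour — one-colour transfer + the Prop 7.19 sequence
bound — or through p2's Conj-A hedge); it is also a counterexample to Perrin-Riou's Conj. 7.1 —
report it. A refutation of Mu at one pair (μ(X^•) > μ(L^•) exhibited) refutes Sprung's MC 7.21 =
Kato's IMC there and closes the route `refuted:MuBoundSmallImageX8`. A refutation of K1 anywhere on
X8 kills C1 (shared with K3: both routes BROKEN). C2/C3 kill criteria as before (BKO App. A / [33]
excluding p = 3 or a_p ≠ 0 ⇒ pivot of the rank-one link to Sprung 2024 Cor. 1.3 on square-free N +
named residual; Sprung 2024 §5.2 failing at an image-3Nn pair ⇒ split C3 by image). Mooted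
(superseded) if a refereed proof of the ♯/♭ (or Kato) main conjecture at (3, ±3) appears.

NOT DECOMPOSED YET. An is class-wide and not split (per-cell certificates + the reading lemma are
`--supports` landings, not items; the one-colour form and the Conj-A road are by-name closers of Mu
— p548147 / p547286 — not a second decomposition); Mu (20622) and SmallImage (20402) keep their
decls as derived support statements (direct attempts welcome: one-colour transfer, Conj-A hedge,
CM-partner transfer = bsd-ssimc L5-CM — not duplicated here); no per-rank split of K1. No Target
item.

CHEAPEST FALSIFIER. DONE (planner g2): (a) join of the 61 cells with the b2b analytic signed-μ
census ss500k_pairs.tsv (engine B exact modular symbols, layers n = 4/5): 61/61 found, μ(θ_n) = 0 at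
BOTH parities on 61/61 (evidence #4 on 20622); (b) Sprung 2012 at the page: Def 6.1 (p.1495), Main
Thm 6.12 (p.1498), Prop 7.19 (p.1505) carry NO image hypothesis (surjectivity enters only Thm 7.18 =
[Ka 12.5] for n = 0) — so the construction fact p543968 is available at N_ns⁺(3); (c) BC7 probes
CLEAN on Mu and An. (d) DONE 17:13Z (ty3 g2 kit j284544, 172 s): two-engine θ_n for n = 0..5 on the
61 cells in the tree convention (γ = 4 ↔ 1+T), A = B coefficientwise, 61/61 CERTIFIED, μ(θ_4) =
μ(θ_5) = 0 (and μ(θ_3) = 0) on 61/61, alerts 0 — NO cell refutes An / PR03 Conj 7.1; λ(θ_4) − q_4 ∈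
{0,…,8}, λ(θ_5) − q_5 ∈ {0,…,10}. Per-cell kernel certificates
`Rank1Residual/PrintX8/CertificateMazurTateRecords{A,B,C,D}.lean` follow the schema p550267 (ty3),
consumed by p3's `ClassX8.signedMuVanishing_of_mazurTate_odd_even`. NEXT cheapest: none cheaper than
a proof — the remaining falsifier of An is a curve OUTSIDE the census (larger N) with stable μ(θ_n)
≥ 1; of Mu, an exhibited μ(X^•) > μ(L^•). Earlier: BKO App. A at the page — DONE rev 1.

NUMBERS. Census of record (K3 cell, `A8_x8_open_cells.v3.tsv`): 217 rows; rank 0: 142 (image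
surjective 82, N_ns⁺(3) 60); rank 1: 75 (surj 74, N_ns⁺(3) 1 = 478400hc1). The 61 small-image cells:
N ∈ [46112, 493790]; Ш_an ∈ {1: 49, 9: 5, 4: 4, 25: 2, 81: 1}; ord_3 of the BSD quotient {0: 2
(135200bx1, 442225bz1 = unit case), 1: 36, 2: 17, 3: 5, 4: 1}; analytic μ readings 61/61 = 0 at
layers 3, 4, 5 (two engines A = B coefficientwise, ty3 g2 j284544; earlier engine-B readings
evidence #4 on 20622). Small-image sub-partition (p3 g2): 54 cells r0 ∧ 3 ∤ #Ш_an — there ONE colour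
of unit content gives BSD(E,3) and MC 7.21 for that colour, K1-free (p548892; reach conditional on
the transcribed #Ш_an, not bookable); 6 cells r0 ∧ 3 ∣ #Ш_an (Ш_an ∈ {9 ×5, 81}) — beyond the rider
the lower half needs K1 at the pair or an exact 3- /9-descent; 1 cell r1 (478400hc1). bsd-ssimc
partition of the same 61: 37 CM-partnered (L5-CM, PRE binder), 18 + 6 partnerless. Certificates:
217/217 records landed (ty3), 12/12 two-engine sample (ref). Route after rev 15: 14 top-level items
+ 2 split families (PublishedInputsX8: 8 held children, OfParts ✓; MuBoundSmallImageX8: An +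
InputSharpFlatMuTransfer (alias InputSharpFlatColemanKatoZeta), glue provable now); open cruxes K1,
Mu ⟸ An; 6 closed; refuter stamps on An / glue / inputs (ref g3).

DEFINITION REQUESTS. No new Lean notion. The ♯/♭ Coleman–Kato construction fact requested at rev 8
HAS LANDED (p543968 `Sprung2012.thm714seq_sharpFlatColemanKato_zeta`, statement-only, ty1 g4 page
audit PASS field-by-field) and is conjunct (i) of the by-name child InputSharpFlatMuTransfer. Texts:
Sprung 2012 held (`paper:doi-10-1016-j-jnt-2011-11-003`); Perrin-Riou 2003 (b2b folder g27/pr03);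
Pollack 2003 acq-06512, Coates–Sujatha 2005 acq-11236, Sprung 2024 journal copy acq-07408 (cite-only
/ open).

Novelty: NOVELTY (rev 16). Searches RUN: rg over the sub's Theses/*.lean for `¬ Surj` ∧
`SprungSharpFlatMainConjecture` / `HasUnitContent (…chromaticL` (0 items elsewhere); `ledger
negatives` (no ♯/♭ or μ statement refuted); lit search --hybrid "sharp flat main conjecture a_p
nonzero p = 3" ([corpus:paper:doi-10-1016-j-jnt-2011-11-003] Sprung 2012 Def 6.1 p.1495 / Thm 7.16
p.1504 (n = 0 needs surjectivity) / Prop 7.19 p.1505 (no image hypothesis)); lit galaxy search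
"non-split Cartan|signed Selmer" --star pdf (Wuthrich 2014 only); DOSSIER T16 (rider in print =
Perrin-Riou 2003 Conj 7.1 p.170, a₃ = ±3 = its Table 2; ♯/♭ read by parity, Sprung ANT 11 (2017)
Table 2 p.912); HL19 Thm 4.6 / LLZ10 §5.4.2 not transcribable at a_p ≠ 0 (ty1 g3). Nearest prior art
in the tree: route SignedLowerHalves (K3) — items 19875/19003/19004 and its lane-B ± μ-transfer
files at a_p = 0; route SmallImage (K6) — ordinary/Eisenstein small image, reduction-free core
(earlier clients ± or ordinary). DELTA: the by-name PRINT assembly of leaf WAllCornerX8 (BKO24 Cor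
A.5, Sprung 2024 §5 all-N, Sprung 2012 7.14/7.16, period unit, GZK) whose only non-print inputs are
K1 by name and — via p3's μ-reading p540766 and p1's ♯/♭ Euler-system μ-transfer at NON-surjective
image p545102 (the core's first ♯/♭ client, over the construction fact p543968) — the analytic rider
An = PR03 Conj 7.1 on the small-image X8 class; no earlier route isolates that rider or works ♯/♭ at
image N_ns⁺(3).  [refs: paper:doi-10-1016-j-jnt-2011-11-003]

Barriers (technique_class: signed-iwasawa-mc, print-import-by-name, es-mu-transfer): - technique_class: signed-iwasawa-mc, print-import-by-name, es-mu-transfer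
- Literature.Barriers.BirchSwinnertonDyer.EulerSystemBigImageBarrier (file
EulerSystemBigImageAtSmallImage.lean, p543964): the PRINTED integral Euler-system divisibilities
(Kato (12.5.2)/Thm 12.5(4), Rubin Hyp(ℚ_∞,T), Sprung 2012 Thm 7.16 n = 0) need
`KatoBigImageHypothesis W p`, which is FALSE on every X8 pair with ρ̄_{E,3} not surjective
(`not_katoBigImageHypothesis_of_classX8_of_not_surj`; on X8,
`katoBigImageHypothesis_iff_surj_of_classX8`). PLACEMENT: K1 (19875) — outside (Eisenstein half, no
Euler-system integrality used); C1 on the 156 surjective pairs — inside and DISCHARGED (surj ⇒ the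
hypothesis holds; Sprung 7.16 n = 0 via Wuthrich 2014 Lemma 20, p534029); the small-image residual —
this barrier is exactly why 20402 / 20622 are not in print, and the route EVADES it: the μ-transfer
(`PrintX8SharpFlatMuTransfer.sharpFlatMu_eq_zero_of_hasUnitContent`, p545102) replaces Kato's
𝐇²-divisibility under big image by the tree's reduction-free core
`CoreAssembly.coreOdd_anyReduction_holds`, whose hypothesis is ¬Surj itself, at the price of the
analytic rider `SharpFlatMuAnSmallImageX8` (one unit coefficient per colour and pair) — so the
rider, not an image hypothesis, is the open input.
- Literature.Barriers.BirchSwinnertonDyer.SelmerRankBarrier: inside the class (Selmer/Iwasawa theory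
sees rank only through Ш[p^∞]); discharged, not evaded — the leaf is restricted to analytic rank ≤ 1
where Ш is finite

History (route lifecycle, newest last):
- 2026-08-27T16:25:26Z · rev 12: restated InputSharpFlatMuTransfer (stmt-BirchSwinnertonDyer-20715) — rev 12: staffability fix after rev 11 — deps.unproved = [thm714seq_sharpFlatColemanKato_zeta cite_only] because split child InputSharpFlatMuTransfer stated the (planner-bsd-print-x8-plan-g2-0)
- 2026-08-27T16:25:55Z · rev 12: restated InputSharpFlatMuTransfer (stmt-BirchSwinnertonDyer-20715) — rev 12: staffability fix after rev 11 — deps.unproved = [thm714seq_sharpFlatColemanKato_zeta cite_only] because split child InputSharpFlatMuTransfer stated the (planner-bsd-print-x8-plan-g2-0)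
- 2026-08-27T16:26:17Z · rev 12: restated InputSharpFlatMuTransfer (stmt-BirchSwinnertonDyer-20715) — rev 12: staffability fix after rev 11 — deps.unproved = [thm714seq_sharpFlatColemanKato_zeta cite_only] because split child InputSharpFlatMuTransfer stated the (planner-bsd-print-x8-plan-g2-0)
- 2026-08-27T16:26:35Z · rev 12: restated InputSharpFlatMuTransfer (stmt-BirchSwinnertonDyer-20715) — rev 12: staffability fix after rev 11 — deps.unproved = [thm714seq_sharpFlatColemanKato_zeta cite_only] because split child InputSharpFlatMuTransfer stated the (planner-bsd-print-x8-plan-g2-0)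
- 2026-08-27T16:28:18Z · rev 12: restated InputSharpFlatMuTransfer (stmt-BirchSwinnertonDyer-20715) — rev 12: staffability fix after rev 11 — deps.unproved = [thm714seq_sharpFlatColemanKato_zeta cite_only] because split child InputSharpFlatMuTransfer stated the (planner-bsd-print-x8-plan-g2-0)
- 2026-08-27T16:46:26Z · rev 15: informal re-worded for SharpFlatMuAnSmallImageX8 (planner-bsd-print-x8-plan-g2-0)
- 2026-08-27T17:35:40Z · rev 16: informal re-worded for SharpFlatMuAnSmallImageX8 (planner-bsd-print-x8-plan-g3-0)
- 2026-08-27T23:05:08Z · CLOSED superseded — superseded:route-BirchSwinnertonDyer-PrintX8VS (planner-bsd-print-x8-plan-g10-0)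

sub-problem: BirchSwinnertonDyer · status: closed(superseded) · opened planner-bsd-print-x8-plan-g0-0 2026-08-27T13:05:18Z · rev 17 · ledger route-BirchSwinnertonDyer-PrintX8
GENERATED by the gate from the ledger (D-0016/17). Provers cite these decls: `theorem foo : Summit.BirchSwinnertonDyer.BirchSwinnertonDyer.Theses.PrintX8.<Decl> := …` in Summits/BirchSwinnertonDyer/BirchSwinnertonDyer/Theorems/<Name>.lean.
-/

namespace Summit.BirchSwinnertonDyer.BirchSwinnertonDyer.Theses.PrintX8

open scoped BigOperators Topology Manifold Classical MeasureTheory ProbabilityTheory Matrix InnerProductSpace ComplexConjugate ContinuousMap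
open Filter Set Function TopologicalSpace MeasureTheory

attribute [summit_statement] _root_.BirchSwinnertonDyer
attribute [summit_statement] _root_.Summit.BirchSwinnertonDyer.WAllCornerX8

open Literature

/-- item stmt-BirchSwinnertonDyer-19875 · crux · rank 3 · open · by planner
why it might fail: Open in print at a_3=±3: Sprung 2024 Thm 1.1 ⇐ Conj 3.33 ∧ CLW22 Thm 8.2.1 at ξ=𝟙 (PRE/OPEN = GAP(G2), via Thm 3.29) ∧ N square-free; CCSS 1804.10993 Thm C rests on withdrawn 1411.6352; BSTW 2024 needs a_p=0; μ(L^•_3)>0 or L^•∤char X^• at one X8 pair refutes it.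
sources: Sprung2024, Sprung2012, CastellaCiperianiSkinnerSprung2018, BurungaleSkinnerTianWan2024, CastellaLiuWan2022, arXiv:1411.6352
[crux] (MC↓•) BY NAME on class X8: for every X8 pair (W, 3) and every colour • ∈ {♯, ♭}, the
Eisenstein half of Sprung's ♯/♭ main conjecture `Theorems.SprungSharpFlatLowerDivisibility W 3 •`
(littype-11 leaf; guarded by `L^• ≠ 0`, so non-degenerate): in the cyclotomic setting of Sprung 2012
Thm 2.2, for every modular Sprung pair (f, ϖ, L♯, L♭) with ϖ·Ω_E = Ω_f⁺ and every model D of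
X^•(E/ℚ_∞) (`Sprung2012.SharpFlatSelmerDualData`), char_Λ(D.X) is principal with a generator
divisible by ϖ·L^•(E). p470332's `hdiv` (∃ •, guard-free) is its corollary via
`Theorems.exists_col_sharpFlatLowerDivisibility`. Kernel status: the opposite divisibility up to
p-power is Sprung 2012 Thm 7.16 (`Sprung2012.thm716_sharpFlatCharIdeal_divisibility`, typed); this
half is printed only for a_p = 0 (Kobayashi 2003 Thm 1.3 ⊗ Wan / BSTW) and is OPEN IN PRINT at (3,
a₃ = ±3). -/
@[route_item "route-BirchSwinnertonDyer-PrintX8", crux]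
def SprungLowerDivisibilityAtThree : Prop :=
  ∀ (W : WeierstrassCurve ℚ) [W.IsElliptic] [W.IsGloballyMinimal] (p : ℕ) [Fact p.Prime], Literature.NumberTheory.EllipticCurves.Rank1Residual.ClassX8 W p → ∀ col : Literature.NumberTheory.EllipticCurves.Sprung2017.Chroma, Summit.BirchSwinnertonDyer.BirchSwinnertonDyer.Theorems.SprungSharpFlatLowerDivisibility W p col

/-- item stmt-BirchSwinnertonDyer-20304 · support · rank 2 · open · by planner
why it might fail: Derived (GlueMainConjectureX8). In print at a_3=±3 only conditionally: Sprung 2024 Thm 1.1 ⇐ Conj 3.33 ∧ CLW22 Thm 8.2.1 at ξ=𝟙 (PRE/OPEN) ∧ N square-free; CCSS Thm C/D on withdrawn 1411.6352; BSTW (1.7)/(h4) is a_p=0. Fails iff K1 or the small-image μ-bound fails at one pair.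
sources: Sprung2012, Wuthrich2014, p534029, CastellaLiuWan2022
[crux] RESIDUAL. For every elliptic curve E/ℚ (global minimal model W), p = 3 of good supersingular
reduction with a_3 ≠ 0 (class X8) and analytic rank ≤ 1, and every colour • ∈ {♯, ♭}: Sprung's ♯/♭
main conjecture at (E, 3, •) in the tree's Néron-normalised form (leaf
`SprungSharpFlatMainConjecture W 3 •`, guarded by L^• ≠ 0): char_Λ X^•(E/ℚ_∞) = (ϖ · L^•_3(E)).
[difficulty: open-problem] -/
@[route_item "route-BirchSwinnertonDyer-PrintX8"]
def SharpFlatMainConjectureX8 : Prop :=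
  ∀ (W : WeierstrassCurve ℚ) [W.IsElliptic] [W.IsGloballyMinimal] (p : ℕ) [Fact p.Prime], Literature.NumberTheory.EllipticCurves.Rank1Residual.ClassX8 W p → W.analyticRank ≤ 1 → ∀ col : Literature.NumberTheory.EllipticCurves.Sprung2017.Chroma, Summit.BirchSwinnertonDyer.BirchSwinnertonDyer.Theorems.SprungSharpFlatMainConjecture W p col

/-- item stmt-BirchSwinnertonDyer-20305 · support · rank 3 · open · by planner
why it might fail: Cor. A.5's proof is "similar arguments as [33, Cor. 1.3(iii)]" (Kobayashi 2014, not held) and its "IMC for f" is unpinned (referee flags BKO24-CorA5-proof-by-reference-Kob14 / -IMC-unpinned): a standing p ≥ 5 or height-non-degeneracy hypothesis inside [33] would leave (3, ±3) uncovered.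
sources: BurungaleKobayashiOta2024, Kobayashi2013, Sprung2012
[crux] PRINT LINK, rank one. On every X8 pair of analytic rank 1, the ♯/♭ main conjecture (both
colours, guarded) implies Miller's missing 3-part `MissingPPartAt W 3` (ord_3 #Ш = ord_3 Ш_an).
Source theorem: Burungale–Kobayashi–Ota, JIMJ 23 (2024) App. A Cor. A.5 "p non-ordinary (good),
ord_{s=1} L(f,s) = 1, IMC for f at p ⇒ p-part of the full BSD conjecture", with Sprung 2012 Prop.
7.19 (♯/♭ MC for a colour with L^• ≠ 0 ⟺ Kato's IMC); closure = the by-name fact (typer ty1,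
`BurungaleKobayashiOta2024.corA5_pPart_of_sharpFlatCharIdeal_eq`, proposal p532534, with kernel
readings `missingPPartAt_of_corA5_sharpFlat` / `X8.bsdp_of_corA5_sharpFlat`) + hypothesis discharge
on ClassX8 (a non-vanishing colour exists by `IsSprungPair.exists_chromaticL_ne_zero`). [deps:
SharpFlatMainConjectureX8] [difficulty: M] -/
@[route_item "route-BirchSwinnertonDyer-PrintX8"]
def SharpFlatRankOneLinkX8 : Prop :=
  ∀ (W : WeierstrassCurve ℚ) [W.IsElliptic] [W.IsGloballyMinimal] (p : ℕ) [Fact p.Prime], Literature.NumberTheory.EllipticCurves.Rank1Residual.ClassX8 W p → W.analyticRank = 1 → (∀ col : Literature.NumberTheory.EllipticCurves.Sprung2017.Chroma, Summit.BirchSwinnertonDyer.BirchSwinnertonDyer.Theorems.SprungSharpFlatMainConjecture W p col) → Literature.NumberTheory.EllipticCurves.Rank1Residual.Typed.MissingPPartAt W p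

/-- item stmt-BirchSwinnertonDyer-20313 · support · rank 4 · open · by planner
why it might fail: Thm 5.3 is printed for square-free N only (49 of 217 census rows); the all-N reading needs the typed Lemma 5.9 fact's cotorsion/finite-Selmer inputs and the Néron normalisation ϖ discharged at EVERY X8 curve (non-optimal, additive primes ℓ ≠ 3), which no page states verbatim.
sources: Sprung2024, Sprung2012, GreenbergVatsal2000
[crux] PRINT LINK, rank zero, ALL levels and BOTH 3-adic images. On every X8 pair of analytic rank
0, the ♯/♭ main conjecture (both colours, guarded) implies `MissingPPartAt W 3`. Source: Sprung,
Adv. Math. 449 (2024) §5.2 — Lemma 5.9 Euler-characteristic identity ξ(0) ∼ #Sel_{3^∞}(E/ℚ)·∏c_ℓ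
(typed all-N: `Sprung2024.lem59AllN_sharpFlatCharValue_rankZero`), control Lemma 5.6 (discharged:
`lem56AllN_…_holds`), interpolation L^•(0) ∼ L(E,1)/Ω (Sprung2012 Prop. 6.14; unit constants on X8:
`ClassX8.not_dvd_chromaticConst'`) ⇒ Thm. 5.3 "|L(E,1)/Ω|_3 = |#Ш ∏ c_ℓ|_3" (printed for square-free
N); with the INTEGRAL equality of C1 no Wuthrich/Kato-image upper bound is needed, so the 61
image-3Nn cells are covered. [deps: SharpFlatMainConjectureX8] [difficulty: L] -/
@[route_item "route-BirchSwinnertonDyer-PrintX8"]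
def SharpFlatRankZeroLinkX8 : Prop :=
  ∀ (W : WeierstrassCurve ℚ) [W.IsElliptic] [W.IsGloballyMinimal] (p : ℕ) [Fact p.Prime], Literature.NumberTheory.EllipticCurves.Rank1Residual.ClassX8 W p → W.analyticRank = 0 → (∀ col : Literature.NumberTheory.EllipticCurves.Sprung2017.Chroma, Summit.BirchSwinnertonDyer.BirchSwinnertonDyer.Theorems.SprungSharpFlatMainConjecture W p col) → Literature.NumberTheory.EllipticCurves.Rank1Residual.Typed.MissingPPartAt W p

/-- item stmt-BirchSwinnertonDyer-20402 · support · rank 4 · closed · moot by None · by planner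
why it might fail: X8 ∩ ¬surj(3) = image N_ns(3), never semistable: Kato's divisibility is only known up to 3^n there (Sprung 2012 Thm 7.16 needs SL2(Z_3) in the image for n = 0; CCSS needs semistable; Fouquet-Wan locus empty) — a positive mu-defect on one of the 61 cells would falsify the Néron-normalised equality
sources: Sprung2012, Kato2004, Wuthrich2014, arXiv:1804.10993, p540766
[crux] NEW RESIDUAL BEYOND KATO. For every X8 pair (E, 3) whose mod-3 representation is NOT
surjective (census: 61 of 217 cells, image the normaliser of a non-split Cartan, 60 of analytic rank
0 and 1 of rank 1, all non-semistable) and analytic rank ≤ 1, Sprung's ♯/♭ main conjecture holds for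
both colours (tree leaf `Theorems.SprungSharpFlatMainConjecture W 3 •`). Given K1 this is exactly
the Kato (upper) half on the small-image pairs, where Sprung 2012 Thm 7.16 only gives divisibility
up to a power of 3 (Kato's (12.5.2) fails: the 3-adic image does not contain SL_2(Z_3)). -/
@[route_item "route-BirchSwinnertonDyer-PrintX8"]
def SharpFlatMainConjectureSmallImageX8 : Prop :=
  ∀ (W : WeierstrassCurve ℚ) [W.IsElliptic] [W.IsGloballyMinimal] (p : ℕ) [Fact p.Prime], Literature.NumberTheory.EllipticCurves.Rank1Residual.ClassX8 W p → ¬ Literature.NumberTheory.EllipticCurves.Rank1Residual.Surj W p → W.analyticRank ≤ 1 → ∀ col : Literature.NumberTheory.EllipticCurves.Sprung2017.Chroma, Summit.BirchSwinnertonDyer.BirchSwinnertonDyer.Theorems.SprungSharpFlatMainConjecture W p col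

/-- item stmt-BirchSwinnertonDyer-19921 · support · rank 9 · open · by operator
sources: GrossZagier1986, Kolyvagin1990
[support] The one PUBLISHED input the halves-glue consumes: Gross–Zagier–Kolyvagin, rank = analytic
rank for analytic rank ≤ 1 with Ш finite (tree named fact
rank_eq_analyticRank_of_analyticRank_le_one; used by bsdp_of_missingPPartAt to turn Miller's last
clause into BSD(E,2)). Carried as a displayed PUB hypothesis; never counted as progress. The further
PRINT of the roads to the two halves (Greenberg Thm-4.1 analogues at a multiplicative prime
thm41Analogue_charValue_rankZero_numberField_anyPrime / …_split_baseChange_anyPrime, modularity) and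
the referee-passed MEMO inputs (Kato ⊗ℚ at a multiplicative 2:
X5.O1.KatoMultiplicativeDivisibilityRat W 2, HOME mult/PROOF-MULT.md RC-2; Greenberg–Stevens at 2:
greenberg_stevens W 2, mult/PROOF-GS2.md RC-4) enter the LINES under the halves (bridge
multiplicativeRankZeroAtTwo_of_muRoad, p409679), not this glue. -/
@[route_item "route-BirchSwinnertonDyer-PrintX8", crux]
def RankEqAnalyticRankLeOne : Prop :=
  Literature.NumberTheory.EllipticCurves.rank_eq_analyticRank_of_analyticRank_le_one

/-- item stmt-BirchSwinnertonDyer-20403 · support · rank 9 · SPLIT (gen 1) into InputBKOCorA5SharpFlat, InputNewform, InputHondaSystem, InputSharpFlatTorsion, InputKatoSharpFlatDivisibility, InputLem59AllN, InputPeriodUnitThree, InputEntireLFunction + glue PublishedInputsX8OfParts · direct attempts still welcome (low priority) · by planner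
sources: BurungaleKobayashiOta2023, Sprung2012, Sprung2024, BCDTJAMS2001, RaySprung2025
[support] HELD PUBLISHED INPUTS of the two print links and of the Kato half, BY NAME (conjunction of
Literature named facts; to be split into by-name children Input* with the anonymous-constructor
glue, PrintX6/SignedLowerHalves idiom; never counted as progress): (1) Burungale–Kobayashi–Ota JIMJ
23 (2024) App. A Cor. A.5 in the ♯/♭ reading via Sprung 2012 Prop 7.19
(`BurungaleKobayashiOta2024.corA5_pPart_of_sharpFlatCharIdeal_eq`, ty1 p532534/p533144; referee flag
PUB* `BKO24-CorA5-sharpflat-via-Spr12-7.19`); (2) modularity `ModularForms.exists_isNewformOf`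
(Wiles–BCDT); (3) Sprung 2012 Thm 2.2 Honda systems `thm22_exists_isHondaSystem`; (4) Sprung 2012
Thm 7.14 `thm714_sharpFlatSelmerDual_finite_torsion`; (5) Sprung 2012 Thm 7.16 (Kato)
`thm716_sharpFlatCharIdeal_divisibility`; (6) Sprung 2024 Lemma 5.9 all N
`Sprung2024.lem59AllN_sharpFlatCharValue_rankZero` (= K3 item 19878, flag
Sprung24-§5.2-allN-via-RaySprung25); (7) period unit at 3
`realPeriodRat_eq_unit_mul_plusPeriod_three` (= item 19291); (8) entire continuation
`WeierstrassCurve.hasEntireLFunction_rat` (= item 19273). -/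
@[route_item "route-BirchSwinnertonDyer-PrintX8", crux]
def PublishedInputsX8 : Prop :=
  Literature.NumberTheory.EllipticCurves.BurungaleKobayashiOta2024.corA5_pPart_of_sharpFlatCharIdeal_eq ∧ Literature.NumberTheory.EllipticCurves.ModularForms.exists_isNewformOf ∧ Literature.NumberTheory.EllipticCurves.Sprung2012.thm22_exists_isHondaSystem ∧ Literature.NumberTheory.EllipticCurves.Sprung2012.thm714_sharpFlatSelmerDual_finite_torsion ∧ Literature.NumberTheory.EllipticCurves.Sprung2012.thm716_sharpFlatCharIdeal_divisibility ∧ Literature.NumberTheory.EllipticCurves.Sprung2024.lem59AllN_sharpFlatCharValue_rankZero ∧ Literature.NumberTheory.EllipticCurves.realPeriodRat_eq_unit_mul_plusPeriod_three ∧ WeierstrassCurve.hasEntireLFunction_rat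

-- parent: PublishedInputsX8 · child (gen 1)
/--     item stmt-BirchSwinnertonDyer-20412 · support · rank 901 · open
    parent: PublishedInputsX8 · by planner
    sources: BurungaleKobayashiOta2023, Sprung2012
[support] BY NAME, published: Burungale–Kobayashi–Ota, J. Inst. Math. Jussieu 23 (2024) App. A Cor.
A.5 (p non-ordinary good for the weight-2 newform f on Γ0(N), p ∤ N, ord_{s=1} L(f,s) = 1, IMC for f
at p ⇒ p-part of BSD) in the ♯/♭ reading via Sprung 2012 Prop. 7.19 — tree named fact typed by ty1
(p532534 + p533144). Referee flag PUB* `BKO24-CorA5-sharpflat-via-Spr12-7.19` (composed citation;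
proof by reference to Kobayashi 2014 [33] Cor. 1.3(iii)). Conjunct 1 of PublishedInputsX8; used by
GlueRankOneLinkX8 only. -/
@[route_item "route-BirchSwinnertonDyer-PrintX8"]
def InputBKOCorA5SharpFlat : Prop :=
  Literature.NumberTheory.EllipticCurves.BurungaleKobayashiOta2024.corA5_pPart_of_sharpFlatCharIdeal_eq

-- parent: PublishedInputsX8 · child (gen 1)
/--     item stmt-BirchSwinnertonDyer-19382 · support · rank 902 · open
    parent: PublishedInputsX8 · by planner
    sources: BCDTJAMS2001
[support] Modularity Theorem, Version L (Diamond–Shurman 2005 Thm. 8.8.3; Wiles / Taylor–Wiles /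
BCDT 2001 Thm. A): every E/ℚ has a weight-2 newform f of level N_E with L(f,s) = L(E,s) — conjunct
of PublishedInputsFive (stmt-BirchSwinnertonDyer-19066), BY NAME; same content, filed as a split
child so the head constant is item-stated (gate5 #15c one rule / readiness rule 2026-08-15: a
cite_only dep must be declared by the route); no crux statement / closes / tribunal / tribunal_fit
change -/
@[route_item "route-BirchSwinnertonDyer-PrintX8"]
def InputNewform : Prop :=
  Literature.NumberTheory.EllipticCurves.ModularForms.exists_isNewformOf

-- parent: PublishedInputsX8 · child (gen 1)
/--     item stmt-BirchSwinnertonDyer-20413 · support · rank 903 · closed · proved by Summit.BirchSwinnertonDyer.BirchSwinnertonDyer.Theorems.PrintX8_InputHondaSystem_proof (prover)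
    parent: PublishedInputsX8 · by planner
    sources: Sprung2012, Kobayashi2003
[support] BY NAME, published: Sprung, J. Number Theory 132 (2012) Thm. 2.2 / Kobayashi 2003 §8 —
existence of a Honda system of points on the formal group along the local cyclotomic tower at a
supersingular prime (any a_p); tree named fact `Sprung2012.thm22_exists_isHondaSystem`. Conjunct 3
of PublishedInputsX8 (rank-zero link). -/
@[route_item "route-BirchSwinnertonDyer-PrintX8"]
def InputHondaSystem : Prop :=
  Literature.NumberTheory.EllipticCurves.Sprung2012.thm22_exists_isHondaSystem

-- `InputHondaSystem` holds: proved by `Summit.BirchSwinnertonDyer.BirchSwinnertonDyer.Theorems.PrintX8_InputHondaSystem_proof` (its module imports this route file, so no `_holds` link can be stated here).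

-- parent: PublishedInputsX8 · child (gen 1)
/--     item stmt-BirchSwinnertonDyer-20414 · support · rank 904 · open
    parent: PublishedInputsX8 · by planner
    sources: Sprung2012, Kato2004
[support] BY NAME, published: Sprung 2012 Thm. 7.14 — the ♯/♭ Selmer duals X^♯, X^♭ over the
cyclotomic Z_3-extension are finitely generated Λ-torsion (via Kato); tree named fact
`Sprung2012.thm714_sharpFlatSelmerDual_finite_torsion`. Conjunct 4 of PublishedInputsX8 (rank-zero
link and the Kato half inside GlueMainConjectureX8). -/
@[route_item "route-BirchSwinnertonDyer-PrintX8"]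
def InputSharpFlatTorsion : Prop :=
  Literature.NumberTheory.EllipticCurves.Sprung2012.thm714_sharpFlatSelmerDual_finite_torsion

-- parent: PublishedInputsX8 · child (gen 1)
/--     item stmt-BirchSwinnertonDyer-20415 · support · rank 905 · open
    parent: PublishedInputsX8 · by planner
    sources: Sprung2012, Kato2004, Wuthrich2014
[support] BY NAME, published: Sprung 2012 Thm. 7.16 (from Kato 2004 Thm. 12.5) — char_Λ X^• divides
(p^n · L^•) for some n, with n = 0 when the 3-adic representation surjects (Wuthrich 2014 Lemma 20
in the tree); tree named fact `Sprung2012.thm716_sharpFlatCharIdeal_divisibility`. Conjunct 5 of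
PublishedInputsX8 (the Kato half on X8 ∩ surj(3) inside GlueMainConjectureX8, via p2's p534029). -/
@[route_item "route-BirchSwinnertonDyer-PrintX8"]
def InputKatoSharpFlatDivisibility : Prop :=
  Literature.NumberTheory.EllipticCurves.Sprung2012.thm716_sharpFlatCharIdeal_divisibility

-- parent: PublishedInputsX8 · child (gen 1)
/--     item stmt-BirchSwinnertonDyer-19878 · support · rank 906 · closed · proved by Summit.BirchSwinnertonDyer.BirchSwinnertonDyer.Theorems.SharpFlatCount.printX8_inputLem59AllN_proof (prover)
    parent: PublishedInputsX8 · by planner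
    sources: Sprung2024, RaySprung2025
[support] (K•) at ALL levels, BY NAME: `Sprung2024.lem59AllN_sharpFlatCharValue_rankZero`
(littype-11, answering W-KDOT-NSF) = the display of `Sprung2024.lem59_sharpFlatCharValue_rankZero`
(Sprung 2024 §5.2 Lemmas 5.5 · 5.8 · 5.9 multiplied, typed p470117) with the single binder
`W.IsSemistable (𝓞 ℚ)` (= §5.2's standing hypothesis «N square-free») deleted: for p odd of good
supersingular reduction (p ∣ a_p), L(E,1) ≠ 0, the cyclotomic / Honda setting of Sprung 2012 Thm
2.2, either colour •, any dual datum D of Sel^•(E/ℚ_∞) finitely generated torsion over Λ, any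
generator f of char(X^•) and Sel_{p^∞}(E/ℚ) finite: f(0) = u · p^{ord_p ∏ c_l} · #Sel_{p^∞}(E/ℚ), u
∈ ℤ_pˣ. PRINT STATUS: stronger than the section-level statement of Sprung 2024; justified by (a) the
refereed attribution Ray–Sprung, Ann. Inst. Fourier 75 (2025) p. 2343 («… given an analogous formula
of Kim's, all assuming that F = ℚ, see [26, Lemmas 4.4, 4.5, 4.8]» — no conductor condition) and (b)
littype-11's line check that square-free N is used in §5 only inside the proof of Thm 5.1 (Ribet),
never in Remark 5.4 / Lemmas 5.5–5.9; flag `Sprung24-§5.2-allN-via-RaySprung25` (supersedes the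
planner's provisional `Sp24-Kdot-b -/
@[route_item "route-BirchSwinnertonDyer-PrintX8"]
def InputLem59AllN : Prop :=
  Literature.NumberTheory.EllipticCurves.Sprung2024.lem59AllN_sharpFlatCharValue_rankZero

-- `InputLem59AllN` holds: proved by `Summit.BirchSwinnertonDyer.BirchSwinnertonDyer.Theorems.SharpFlatCount.printX8_inputLem59AllN_proof` (its module imports this route file, so no `_holds` link can be stated here).

-- parent: PublishedInputsX8 · child (gen 1)
/--     item stmt-BirchSwinnertonDyer-19291 · support · rank 907 · closed · proved by Summit.BirchSwinnertonDyer.BirchSwinnertonDyer.Theorems.SignedLowerHalves.RealPeriodUnitPlusPeriodThree_proof (prover)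
    parent: PublishedInputsX8 · by operator
    sources: Sprung2024, Wuthrich2014
[support] the same period ratio statement at p = 3 (Manin constant a 3-adic unit in the cases used)
— conjunct of PublishedSignedInputs (stmt-BirchSwinnertonDyer-19005), BY NAME; same content, filed
as a split child so the head constant is item-stated (gate5 #15c one rule; readiness rule
2026-08-15: cite_only dep declared by the route); no statement / closes / tribunal change -/
@[route_item "route-BirchSwinnertonDyer-PrintX8"]
def InputPeriodUnitThree : Prop :=
  Literature.NumberTheory.EllipticCurves.realPeriodRat_eq_unit_mul_plusPeriod_three

/-- `InputPeriodUnitThree` holds: proved by `Summit.BirchSwinnertonDyer.BirchSwinnertonDyer.Theorems.SignedLowerHalves.RealPeriodUnitPlusPeriodThree_proof`. -/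
theorem InputPeriodUnitThree_holds : InputPeriodUnitThree := _root_.Summit.BirchSwinnertonDyer.BirchSwinnertonDyer.Theorems.SignedLowerHalves.RealPeriodUnitPlusPeriodThree_proof

-- parent: PublishedInputsX8 · child (gen 1)
/--     item stmt-BirchSwinnertonDyer-19273 · support · rank 908 · open
    parent: PublishedInputsX8 · by planner
    sources: BCDTJAMS2001
[support] entire continuation of L(E/ℚ, s) (modularity: Breuil–Conrad–Diamond–Taylor 2001 Thm A +
Hecke/Shimura), BY NAME — conjunct of MultConversePublishedInputsAtTwo (19185); same content, filed
so the head constant is item-stated (#15c one rule; cite_only dep) -/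
@[route_item "route-BirchSwinnertonDyer-PrintX8"]
def InputEntireLFunction : Prop :=
  WeierstrassCurve.hasEntireLFunction_rat

-- parent: PublishedInputsX8 · glue (gen 1)
/--     item stmt-BirchSwinnertonDyer-20416 · support · rank 909 · closed · proved by Summit.BirchSwinnertonDyer.BirchSwinnertonDyer.Theorems.PrintX8Glue.publishedInputsX8OfParts_holds (prover)
    parent: PublishedInputsX8 · GLUE: children ⟹ parent · by planner
OfParts: the eight published inputs BY NAME (one tree named-fact constant each; 19878/19291/19273
shared with SignedLowerHalves/PrintX6) ⇒ their conjunction PublishedInputsX8; proof = the anonymous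
constructor ⟨h1, …, h8⟩ (PrintX6 `PublishedInputsX6` idiom). Item-states every cite_only constant in
the cone so the route is staffable. -/
@[route_item "route-BirchSwinnertonDyer-PrintX8"]
def PublishedInputsX8OfParts : Prop :=
  InputBKOCorA5SharpFlat → InputNewform → InputHondaSystem → InputSharpFlatTorsion → InputKatoSharpFlatDivisibility → InputLem59AllN → InputPeriodUnitThree → InputEntireLFunction → PublishedInputsX8

-- `PublishedInputsX8OfParts` holds: proved by `Summit.BirchSwinnertonDyer.BirchSwinnertonDyer.Theorems.PrintX8Glue.publishedInputsX8OfParts_holds` (its module imports this route file, so no `_holds` link can be stated here).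

/-- item stmt-BirchSwinnertonDyer-20404 · support · rank 9 · closed · proved by Summit.BirchSwinnertonDyer.BirchSwinnertonDyer.Theorems.PrintX8MainConjectureSplit.glueMainConjectureX8_holds (prover) · by planner
sources: Sprung2012, Wuthrich2014
[support] GLUE of the C1 decomposition (PROVABLE NOW): K1 (Eisenstein half on X8, by name) → ♯/♭ MC
on the small-image X8 pairs of rank ≤ 1 → the published inputs (Sprung 2012 Thms 7.14/7.16, period
unit at 3, inside PublishedInputsX8) → C1 `SharpFlatMainConjectureX8`. Proof: case split on `Surj W
3`; surjective ⇒ p2's landed class theorem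
`Theorems.sprungMainConjecture_surjBranch_of_sprungLowerDivisibilityAtThree h714 h716 h3 hK1`
(p534029; Λ a UFD: L^• ∣ gen ∣ L^•); non-surjective ⇒ the small-image crux. Shape-checked in the
planner's Sketch3.lean (`glueMainConjectureX8_of_surjBranch`, farm rc 0). To land:
Theorems/PrintX8MainConjectureSplit.lean (prover p2). -/
@[route_item "route-BirchSwinnertonDyer-PrintX8", crux]
def GlueMainConjectureX8 : Prop :=
  SprungLowerDivisibilityAtThree → SharpFlatMainConjectureSmallImageX8 → PublishedInputsX8 → SharpFlatMainConjectureX8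

-- `GlueMainConjectureX8` holds: proved by `Summit.BirchSwinnertonDyer.BirchSwinnertonDyer.Theorems.PrintX8MainConjectureSplit.glueMainConjectureX8_holds` (its module imports this route file, so no `_holds` link can be stated here).

/-- item stmt-BirchSwinnertonDyer-20408 · support · rank 9 · closed · proved by Summit.BirchSwinnertonDyer.BirchSwinnertonDyer.Theorems.PrintX8Glue.glueRankOneLinkX8_holds (prover) · by planner
sources: BurungaleKobayashiOta2023, Sprung2012
[support] GLUE, rank-one print link (PROVABLE NOW): the held published inputs (BKO 2024 App. A Cor.
A.5 ♯/♭ reading, modularity, entire continuation — conjuncts 1, 2, 8 of PublishedInputsX8) and GZK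
by name give C2 `SharpFlatRankOneLinkX8`. Proof: unpack the conjunction and apply p1's kernel
theorem `X8MainConjectureRoad.sharpFlatRankOneLinkX8_of_namedFacts hBKO hmodf hGZK hL`
(Theorems/PrintX8SharpFlatLinks.lean, p534646; discharge of Cor. A.5's hypotheses on ClassX8 ∧ r_an
= 1: 3 good, 3 ∣ a_3, newform of level N_E with 3 ∤ N_E by
`not_dvd_conductorNorm_of_hasGoodReductionAtPrime`, a non-vanishing colour by
`IsSprungPair.exists_chromaticL_ne_zero`). Referee flag carried by conjunct 1: PUB*
`BKO24-CorA5-sharpflat-via-Spr12-7.19`. -/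
@[route_item "route-BirchSwinnertonDyer-PrintX8", crux]
def GlueRankOneLinkX8 : Prop :=
  PublishedInputsX8 → RankEqAnalyticRankLeOne → SharpFlatRankOneLinkX8

-- `GlueRankOneLinkX8` holds: proved by `Summit.BirchSwinnertonDyer.BirchSwinnertonDyer.Theorems.PrintX8Glue.glueRankOneLinkX8_holds` (its module imports this route file, so no `_holds` link can be stated here).

/-- item stmt-BirchSwinnertonDyer-20409 · support · rank 9 · closed · proved by Summit.BirchSwinnertonDyer.BirchSwinnertonDyer.Theorems.PrintX8Glue.glueRankZeroLinkX8_holds (prover) · by planner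
sources: Sprung2024, Sprung2012, RaySprung2025
[support] GLUE, rank-zero print link (PROVABLE NOW): the held published inputs (modularity, Sprung
2012 Thm 2.2 Honda systems, Thm 7.14 torsion, Sprung 2024 Lemma 5.9 all N, period unit at 3, entire
continuation — conjuncts 2, 3, 4, 6, 7, 8 of PublishedInputsX8) and GZK by name give C3
`SharpFlatRankZeroLinkX8` at EVERY X8 pair of analytic rank 0, any 3-adic image, any N. Proof:
unpack and apply p1's kernel theorem
`X8MainConjectureRoad.X8.missingPPartAt_of_sprungSharpFlatMainConjecture_of_analyticRank_eq_zero
hmodf h22 h714 h59 h3 hGZK hmod W p hX h0 hMC` (Theorems/PrintX8SharpFlatRankZeroRoad.lean, p533869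
ACCEPTED: MC(T=0) + Lemma 5.9 + unit interpolation constants `ClassX8.not_dvd_chromaticConst'` +
control `lem56AllN…_holds` ⇒ ord_3 equality ⇒ MissingPPartAt; no Kato/Surj input). -/
@[route_item "route-BirchSwinnertonDyer-PrintX8", crux]
def GlueRankZeroLinkX8 : Prop :=
  PublishedInputsX8 → RankEqAnalyticRankLeOne → SharpFlatRankZeroLinkX8

-- `GlueRankZeroLinkX8` holds: proved by `Summit.BirchSwinnertonDyer.BirchSwinnertonDyer.Theorems.PrintX8Glue.glueRankZeroLinkX8_holds` (its module imports this route file, so no `_holds` link can be stated here).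

/-- item stmt-BirchSwinnertonDyer-20772 · support · rank 911 · open · by planner
sources: Sprung2012, Kato2004, p543968
[support] BY-NAME HELD FACT (rev 12, 1:1 alias so the staffability cone exempts it `item-states`):
`Literature.NumberTheory.EllipticCurves.Sprung2012.thm714seq_sharpFlatColemanKato_zeta` (p543968, p1
g2, statement-only; Sprung 2012 Def 6.1 p.1495 (L♯,L♭) := ε Col(z_Kato), Props 7.3/7.6, Thm 7.14 (3)
p.1504, Prop 7.19 p.1505 + Kato Thms 12.5/12.6: the ♯/♭ Coleman–Kato construction package —
Col^•∘loc, Kato zeta submodule, the pair on ideals at height-one primes, the ♯/♭ Poitou–Tate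
sequence; NO image hypothesis; ty1 g4 auditing it field-by-field against the page). Conjunct 1 of
the split child InputSharpFlatMuTransfer of MuBoundSmallImageX8. Held Literature fact: enters as a
hypothesis, never proved here. [difficulty: held] -/
@[route_item "route-BirchSwinnertonDyer-PrintX8"]
def InputSharpFlatColemanKatoZeta : Prop :=
  Literature.NumberTheory.EllipticCurves.Sprung2012.thm714seq_sharpFlatColemanKato_zeta

/-- item stmt-BirchSwinnertonDyer-20622 · crux · rank 4 · closed · moot by None · by planner
why it might fail: = μ-part of Kato's IMC divisibility at image N_ns⁺(3), in print only under big image (12.5.2) (fails on all 61: ∩SL₂(𝔽₃)=Q₈; EulerSystemBigImageBarrier) — reachable only via the analytic rider (child An, p545102) or Coates–Sujatha A; one pair among the 61 with μ(X^•) > μ(Λ/(L^•)) refutes it.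
sources: Sprung2012, Kato2004, PerrinRiou2003, CoatesSujatha2005, p545102, p540766
retired/moot children: InputSharpFlatMuTransfer [replaced: Literature.NumberTheory.EllipticCurves.Sprung2012.thm714seq_sharpFlatColemanKato]
[crux] MU-BOUND ON THE SMALL-IMAGE X8 PAIRS — the residual of item 20402 beyond K1 (p3 g1
MuReading/MuSplit, p539576/p540766, REF R-30/R-35 PASS). For every X8 pair (E,3) (good
supersingular, a_3 = ±3) whose mod-3 image is NOT surjective (61 census cells, image N_ns⁺(3); 60 of
analytic rank 0, 1 of rank 1) and analytic rank ≤ 1, every colour • ∈ {♯,♭}, every cyclotomic (κ,γ)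
/ place v | 3 / Honda system / newform f / Sprung pair (L♯,L♭) with L^• ≠ 0, and every model D of
the ♯/♭ Selmer dual X^•(E/ℚ_∞) (`Sprung2012.SharpFlatSelmerDualData`): μ(D.X) ≤ μ(Λ/(L^•)). Given K1
(19875) this IS Sprung's Main Conjecture 7.21 on those pairs (char X^• = (3^m L^•) exactly, m =
μ-defect; p3 `PrintX8MuReading`), and with PublishedInputsX8 it yields 20402 (glue item
GlueMuBoundSmallImageX8, provable now); conversely 20402 ⇒ μ-equality (p3). PRINT STATUS: not in
print at a_3 = ±3 — it is the μ-part of Kato's divisibility, printed only under (12.5.2), which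
fails at image N_ns⁺(3) (∩ SL₂(𝔽₃) = Q₈). LINE OF THIS CELL (distinct from bsd-ssimc L5-CM =
CM-partner congruence transfer, PRE, 37 of 61 cells): partner-free EULER-SYSTEM μ-TRANSFER — the
tree's reduction-free core `Rank1Residual.CoreAssembly.c -/
@[route_item "route-BirchSwinnertonDyer-PrintX8", crux]
def MuBoundSmallImageX8 : Prop :=
  ∀ (W : WeierstrassCurve ℚ) [W.IsElliptic] [W.IsGloballyMinimal] (p : ℕ) [Fact p.Prime], Literature.NumberTheory.EllipticCurves.Rank1Residual.ClassX8 W p → ¬ Literature.NumberTheory.EllipticCurves.Rank1Residual.Surj W p → W.analyticRank ≤ 1 → ∀ col : Literature.NumberTheory.EllipticCurves.Sprung2017.Chroma, ∀ (κ : Literature.NumberTheory.EllipticCurves.ZpExtension ℚ p) (γ : Field.absoluteGaloisGroup ℚ), κ.IsCyclotomic → κ.IsTopGenerator γ → Literature.NumberTheory.EllipticCurves.IsCyclotomicVariable p γ → ∀ (v : IsDedekindDomain.HeightOneSpectrum (NumberField.RingOfIntegers ℚ)), (p : NumberField.RingOfIntegers ℚ) ∈ v.asIdeal → ∀ (g :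 Field.absoluteGaloisGroup (v.adicCompletion ℚ)), κ.IsTopGenerator (Literature.NumberTheory.EllipticCurves.resGalOfEmb (Literature.NumberTheory.EllipticCurves.closureEmb (K := ℚ) (v.adicCompletion ℚ)) g) → ∀ (cneg : Literature.NumberTheory.EllipticCurves.localPoints W (v.adicCompletion ℚ)) (c : ℕ → Literature.NumberTheory.EllipticCurves.localPoints W (v.adicCompletion ℚ)), Literature.NumberTheory.EllipticCurves.Sprung2012.IsHondaSystem κ (Literature.NumberTheory.EllipticCurves.closureEmb (K := ℚ) (v.adicCompletion ℚ)) W (W.frobeniusTrace p) g cneg c → ∀ (N : ℕ) (_ : NeZero N) (f : CuspForm (CongruenceSubgroup.Gamma0 N) 2) (Lsharp Lflat : Literature.NumberTheory.EllipticCurves.IwasawaAlgebra p), Literature.NumberTheory.EllipticCurves.ModularForms.IsNewformOf W f → Literature.NumberTheory.EllipticCurves.Sprung2017.IsSprungPair f p (W.frobeniusTrace p) Lsharp Lflat → Literature.NumberTheory.EllipticCurves.Sprung2017.chromaticL col Lsharp Lflat ≠ 0 → ∀ D : Literature.NumberTheory.EllipticCurves.Sprung2012.SharpFlatSelmerDualData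 W κ γ (Literature.NumberTheory.EllipticCurves.closureEmb (K := ℚ) (v.adicCompletion ℚ)) (W.frobeniusTrace p) g c col, Literature.NumberTheory.EllipticCurves.muInvariant p D.X ≤ Literature.NumberTheory.EllipticCurves.muInvariant p (Literature.NumberTheory.EllipticCurves.IwasawaAlgebra p ⧸ Ideal.span {Literature.NumberTheory.EllipticCurves.Sprung2017.chromaticL col Lsharp Lflat})

-- parent: MuBoundSmallImageX8 · child (gen 1)
/--     item stmt-BirchSwinnertonDyer-20714 · crux · rank 401 · closed · moot by None
    parent: MuBoundSmallImageX8 · by planner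
    why it might fail: = Perrin-Riou 2003 Conj 7.1 (µ₊=µ₋=0; ♯/♭ by parity) on the infinite family {E/ℚ good ss at 3, a₃=±3, ρ̄ not onto}: open class-wide, nothing in print at a_p≠0; ONE curve with non-unit content of L^•_3 (stable μ(θ_n)≥1 at one parity) refutes it; census 61/61 two-engine certified μ(θ_3..5)=0.
    sources: PerrinRiou2003, Sprung2017, Sprung2012, Pollack2003, arXiv:2409.18021, p545102
[crux] ANALYTIC RIDER ON THE SMALL-IMAGE X8 CLASS (rev 11, child 1 of the split of
MuBoundSmallImageX8 20622; p1 g2's hμan binder VERBATIM,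
HOME/P1-SharpFlatMuAnSmallImageX8-signature.lean.txt): for EVERY elliptic curve E/ℚ with good
supersingular reduction at 3, a₃ = ±3 and ρ̄_{E,3} NOT surjective (image N_ns⁺(3); an infinite CLASS
— the K3 census shows 61 such cells), every colour • ∈ {♯,♭}, every newform f of E and every Sprung
pair (L♯,L♭) of f at 3: L^• ≠ 0 ⇒ L^• has UNIT CONTENT (some coefficient a 3-adic unit), i.e.
analytic μ(L^•_3(E)) = 0; no rank hypothesis. IN PRINT = Perrin-Riou, Exp. Math. 12 (2003) §7.1
Conjecture 7.1 (p. 170; = arXiv §6.1 Conj. 6.1.1; a₃ = ±3 curves = its Table 2) «les invariants µ₊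
et µ₋ de L_p(E/ℚ) sont nuls», read ♯/♭ BY PARITY — odd layers ↔ L♯ ↔ µ₋, even layers ↔ L♭ ↔ µ₊
(Perrin-Riou p. 165; Kobayashi 2003 p. 7; Sprung ANT 11 (2017) Table 2 p. 912 / Def 7.6; kernel
`red_sharp_ne_zero_of_mazurTate_odd` / `…_flat_…_even`) — so An at a pair ⟺ Conj. 7.1 at (E, 3) (lit
g4 DOSSIER v1.6 T16 amendment: Sprung 2017 arXiv Cor. 3.6 = ANT Cor. 8.9 prints the ± labels swapped
and is NOT the dictionary), restricted to this family — an OPEN conjecture class-wi -/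
@[route_item "route-BirchSwinnertonDyer-PrintX8"]
def SharpFlatMuAnSmallImageX8 : Prop :=
  ∀ (W : WeierstrassCurve ℚ) [W.IsElliptic] [W.IsGloballyMinimal] (p : ℕ) [Fact p.Prime], Literature.NumberTheory.EllipticCurves.Rank1Residual.ClassX8 W p → ¬ Literature.NumberTheory.EllipticCurves.Rank1Residual.Surj W p → ∀ (col : Literature.NumberTheory.EllipticCurves.Sprung2017.Chroma) (N : ℕ) (_ : NeZero N) (f : CuspForm (CongruenceSubgroup.Gamma0 N) 2) (Lsharp Lflat : Literature.NumberTheory.EllipticCurves.IwasawaAlgebra p), Literature.NumberTheory.EllipticCurves.ModularForms.IsNewformOf W f → Literature.NumberTheory.EllipticCurves.Sprung2017.IsSprungPair f p (W.frobeniusTrace p) Lsharp Lflat → Literature.NumberTheory.EllipticCurves.Sprung2017.chromaticL col Lsharp Lflat ≠ 0 → Literature.NumberTheory.EllipticCurves.GreenbergVatsal2000.HasUnitContent (Literature.NumberTheory.EllipticCurves.Sprung2017.chromaticL col Lsharp Lflat)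

-- parent: MuBoundSmallImageX8 · child (gen 1)
/--     item stmt-BirchSwinnertonDyer-20771 · support · rank 402 · open
    parent: MuBoundSmallImageX8 · by planner
    sources: Sprung2012, Kato2004, p543968
[support] BY-NAME HELD FACTS of the μ-transfer (rev 11, child 2 of the split of MuBoundSmallImageX8
20622): (i) `Sprung2012.thm714seq_sharpFlatColemanKato_zeta` (p543968, p1 g2, statement-only; Sprung
2012 Def 6.1 p.1495 (L♯,L♭) := ε Col(z_Kato), Props 7.3/7.6, Thm 7.14 (3) p.1504, Prop 7.19 p.1505 +
Kato Thms 12.5/12.6 — the ♯/♭ Coleman–Kato construction package: Col^•∘loc, Kato zeta submodule, the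
pair on ideals at height-one primes, the ♯/♭ Poitou–Tate sequence; NO image hypothesis; ty1 g4
auditing it field-by-field) ∧ (ii) the period unit at 3 `realPeriodRat_eq_unit_mul_plusPeriod_three`
(= conjunct 7 of PublishedInputsX8 = InputPeriodUnitThree, repeated here so the generated glue needs
no third hypothesis). Held Literature facts: close by citation as hypotheses, never proved here.
[difficulty: held] -/
@[route_item "route-BirchSwinnertonDyer-PrintX8"]
def InputSharpFlatMuTransfer : Prop :=
  InputSharpFlatColemanKatoZeta ∧ InputPeriodUnitThree

-- parent: MuBoundSmallImageX8 · glue (gen 1)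
/--     item stmt-BirchSwinnertonDyer-20716 · support · rank 403 · closed · proved by Summit.BirchSwinnertonDyer.BirchSwinnertonDyer.Theorems.PrintX8MuAnGlue.glueMuAnSmallImageX8_holds (prover)
    parent: MuBoundSmallImageX8 · GLUE: children ⟹ parent · by planner
GLUE of the split of MuBoundSmallImageX8 (rev 11, PROVABLE NOW): SharpFlatMuAnSmallImageX8 →
InputSharpFlatMuTransfer → MuBoundSmallImageX8, by p1 g2's Euler-system μ-transfer at NON-surjective
image `Theorems.PrintX8SharpFlatMuTransfer.muBound_smallImageX8_of_sharpFlatMuAn` (p545102): proof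
`fun hAn hIn => muBound_smallImageX8_of_sharpFlatMuAn hIn.1 hIn.2 hAn` (planner an/SketchSplit.lean
farm rc 0, axioms standard). To land: Theorems/PrintX8MuAnGlue.lean --workitem <this glue item> (p1
g2). -/
@[route_item "route-BirchSwinnertonDyer-PrintX8"]
def GlueMuAnSmallImageX8 : Prop :=
  SharpFlatMuAnSmallImageX8 → InputSharpFlatMuTransfer → MuBoundSmallImageX8

-- `GlueMuAnSmallImageX8` holds: proved by `Summit.BirchSwinnertonDyer.BirchSwinnertonDyer.Theorems.PrintX8MuAnGlue.glueMuAnSmallImageX8_holds` (its module imports this route file, so no `_holds` link can be stated here).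

/-- item stmt-BirchSwinnertonDyer-20623 · support · rank 9 · closed · proved by Summit.BirchSwinnertonDyer.BirchSwinnertonDyer.Theorems.PrintX8MuBoundGlue.glueMuBoundSmallImageX8_holds (prover) · by planner
sources: p540766, Sprung2012
[support] GLUE of the μ-split of 20402 (PROVABLE NOW): K1 `SprungLowerDivisibilityAtThree` → μ-bound
`MuBoundSmallImageX8` → `PublishedInputsX8` (conjuncts 4, 5, 7: Sprung 2012 Thm 7.14, Thm 7.16 first
clause, period unit at 3) → `SharpFlatMainConjectureSmallImageX8`. Proof = `fun hK1 hμ hPub =>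
Theorems.PrintX8MuSplit.sharpFlatMainConjectureSmallImageX8_of_publishedInputs_of_K1_of_muBound hPub
hK1 hμ` (p3 g1, p540766; planner SketchMu.lean farm rc 0). To land: Theorems/PrintX8MuGlue.lean (any
prover, --workitem <this item>). [deps: SprungLowerDivisibilityAtThree, MuBoundSmallImageX8,
PublishedInputsX8, SharpFlatMainConjectureSmallImageX8] [difficulty: provable-now] -/
@[route_item "route-BirchSwinnertonDyer-PrintX8", crux]
def GlueMuBoundSmallImageX8 : Prop :=
  SprungLowerDivisibilityAtThree → MuBoundSmallImageX8 → PublishedInputsX8 → SharpFlatMainConjectureSmallImageX8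

-- `GlueMuBoundSmallImageX8` holds: proved by `Summit.BirchSwinnertonDyer.BirchSwinnertonDyer.Theorems.PrintX8MuBoundGlue.glueMuBoundSmallImageX8_holds` (its module imports this route file, so no `_holds` link can be stated here).

/-- item stmt-BirchSwinnertonDyer-20314 · assembly · rank 1 · closed · proved by Summit.BirchSwinnertonDyer.BirchSwinnertonDyer.Theorems.PrintX8Assembly.assembly_holds (prover) · by planner
sources: Miller2011LMS, Sprung2024, BurungaleKobayashiOta2023
[assembly] C1 → C2 → C3 → (GZK by name) → the X8 leaf WAllCornerX8: case split on the analytic rank,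
the link of that rank, `bsdp_of_missingPPartAt`. -/
@[route_item "route-BirchSwinnertonDyer-PrintX8", crux]
def Assembly : Prop :=
  SharpFlatMainConjectureX8 → SharpFlatRankOneLinkX8 → SharpFlatRankZeroLinkX8 → RankEqAnalyticRankLeOne → Summit.BirchSwinnertonDyer.WAllCornerX8

-- `Assembly` holds: proved by `Summit.BirchSwinnertonDyer.BirchSwinnertonDyer.Theorems.PrintX8Assembly.assembly_holds` (its module imports this route file, so no `_holds` link can be stated here).

/-! D-0027 §2.1 — DECIDING THEOREM (planner-authored via `route open/edit --closes-file`; by planner-bsd-print-x8-plan-g2-0 2026-08-27T15:24:15Z) — ARCHIVED: route closed (superseded) 2026-08-27T23:05:07Z; kept so importers keep building: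
its hypotheses are this route's items and its conclusion the registered leaf `Summit.BirchSwinnertonDyer.WAllCornerX8` (rung W-ALL/8, D-0061) (glue_lint), and it elaborates with this file. -/

@[closes "route-BirchSwinnertonDyer-PrintX8"] theorem closes (hAsm : Assembly) (hK1 : SprungLowerDivisibilityAtThree)
    (hMu : MuBoundSmallImageX8) (hPub : PublishedInputsX8)
    (hGlueMu : GlueMuBoundSmallImageX8) (hGlueMC : GlueMainConjectureX8)
    (hGlue1 : GlueRankOneLinkX8) (hGlue0 : GlueRankZeroLinkX8)
    (hGZK : RankEqAnalyticRankLeOne) : _root_.Summit.BirchSwinnertonDyer.WAllCornerX8 := by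
  -- rev 7: the small-image ♯/♭ main conjecture (item 20402, now DERIVED) is obtained from K1 (= SignedLowerHalves
  -- item 19875, by name) + the μ-bound crux on the 61 N_ns⁺(3) pairs + the published inputs via
  -- `GlueMuBoundSmallImageX8` (p3's class form, p540766); then as in rev 2: C1 via `GlueMainConjectureX8`,
  -- the two print links via their glue items, and the (proved) Assembly C1 → C2 → C3 → GZK → leaf.
  unfold Assembly at hAsm
  exact hAsm (hGlueMC hK1 (hGlueMu hK1 hMu hPub) hPub) (hGlue1 hPub hGZK) (hGlue0 hPub hGZK) hGZK

end Summit.BirchSwinnertonDyer.BirchSwinnertonDyer.Theses.PrintX8
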